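import Summits.QuantumFields.BalabanUV.Beta.E3LevelOneReflection

/-!
# The reflection law of the resolvent-GENERIC level-1 third jet `−mmRead Lc (K ∘ vertexOfK K Lc S0NAt ∘ K)`, contact explicit

HONEST FRAMING (pub-balaban β cell). Discharging `BetaPertH` makes Balaban's UV stability UNCONDITIONAL — a real
constructive-QFT result; it is NOT the continuum limit and NOT the Clay problem. This module is NOT (D1), NOT `BetaPertH`.
HONEST DEPENDENCY: continuum YM on `T⁴` ⇐ `BetaPertH` ∧ nine spine estimates (0/9 proved); `BetaPertH` ⇐ (D1) ∧ (D4) ∧ CAP+tail.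

WHAT IS PROVED ([folklore] kernel algebra; no analytic number is produced). Lineage an3; serves the row owner's (L3-D) re-typing
(an2 DECISION, journal l.7124): the step jets are re-defined over a resolvent `K` that enters BOTH the chain-rule vertex weights
(`vertexOfK K N S`, the `ℋ`-column of `K`) and the `mm`-read sandwich, `e3OfKAt K S κ′ u′ := −mmRead N (K ∘ vertexOfK K N S κ′ u′ ∘ K)`.
`E3LevelOneReflection` treated the case "vertex weights from the straight `KInv`, sandwich generic"; here BOTH are the same generic `K`.
Write `ρ := ctr (d+1) Lc`, `ε := reflSign α μ`, `V_K μ y := vertexOfK K Lc (S0NAt d Lc ρ cE cVH cΛ) μ y` and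

  `W_K α μ y := conjV (bhKAt d ρ Lc) ((cVH / Lc^{d+1}) • diagK (p c ↦ Σ_κ Σ'_u colH K Lc μ y κ u · ctGen d α Lc κ u p c))`,
  `𝒞_K α μ y := −mmRead Lc (K ∘ W_K α μ y ∘ K)`.

For ANY packed kernel `K` that decays (`TameKernelCalculus.Spr K`) and is reflection-invariant (`refK (Φ Lc α) K = K`), under
`2·cVH = −cE·Lc^{d+1}` and `Odd Lc`:
* §1 `vertexOfK_S0NAt_bref`: `V_K μ (bref α μ y) = ε • refK (Φ Lc α) (V_K μ y + W_K α μ y)` (the stencil law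
  `S0NAtReflection.S0NAt_bref` through `VertexReflectionContact.vertexOfK_bref_contact` / `vertexOfK_conjV_diagK`);
* §2 `loc_vertexOfK_S0NAt`, `loc_contactK`: `V_K μ y` and `W_K α μ y` are localised (`vertexFamily_vertexOfK'`;
  `E3LevelOneReflection.contact_eq_of_law` + `loc_refK_Φ`);
* §3 `neg_mmRead_sandwich_vertexOfK_S0NAt_bref`: **`−mmRead Lc (K ∘ V_K μ (bref α μ y) ∘ K) = ε • refK (Φ Lc α) (−mmRead Lc
  (K ∘ V_K μ y ∘ K) + 𝒞_K α μ y)`**, its field–field entries `…_inl_inl` in the spelling of the socket `hE3ff`, and `e3KLaw_ff_iff`: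
  the `hE3ff`-shaped law with a candidate `C′` in the contact slot holds at `(α, μ, y)` iff `𝒞_K α μ y` and `C′` have the same
  field–field block — the (L3-D) socket at level 1 is the evaluation of `(𝒞_K)_ff` for the dressed resolvent, nothing else.

This module asserts nothing about that evaluation (row owner's), nor about which `K` the wall family uses.
-/

noncomputable section

open Finset
open scoped BigOperators
open Literature.MathematicalPhysics.QuantumFieldTheory
open Literature.MathematicalPhysics.QuantumFieldTheory.Balaban1983to89
open Literature.MathematicalPhysics.QuantumFieldTheory.Balaban1983to89.Beta
open ExpKernelCalculus (MKer comp Decays BiLoc VertexFamily)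
open PolarizationSign (reflSign)
open KernelReflection (LegMap refK refK_apply)
open ResolventReflection (bref bref_bref Φ Φ_r_inl Φ_r_inr Φ_s_inl Φ_s_inr reflSign_mul_self)
open OneStepResolventKernel (Fib LocStencil)
open OneStepKernelFamily (colH vertexOfK vertexFamily_vertexOfK')
open BalabanStepJetsSucc (mmRead)
open AffineAveraging (box toSite)
open AveragingContoursRooted (ctr ctrOff ctrOff_mem_box)
open Summit.QuantumFields.BalabanUV.Beta.ChartConjugation (conjV)
open Summit.QuantumFields.BalabanUV.Beta.BorderedHessian (bhKAt ctGen diagK conjV_diagK_apply)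
open Summit.QuantumFields.BalabanUV.Beta.SpineRooted (S0NAt locStencil_S0NAt)
open Summit.QuantumFields.BalabanUV.Beta.S0NAtReflection (S0NAt_bref)
open Summit.QuantumFields.BalabanUV.Beta.TameKernelCalculus (Spr Loc Tame slice_tame)
open Summit.QuantumFields.BalabanUV.Beta.VertexReflectionContact (vertexOfK_bref_contact vertexOfK_conjV_diagK smul_diagK
  summable_colH_mul_of_locStencil summable_colH_mul_ctGen neg_mmRead_sandwich_bref)
open Summit.QuantumFields.BalabanUV.Beta.E3LevelOneReflection (Φ_r_r contact_eq_of_law loc_refK_Φ)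

namespace Summit.QuantumFields.BalabanUV.Beta.E3GenericReflection

variable {d Lc : ℕ} [NeZero Lc]

/-- [folklore] A spread kernel decays at a positive rate with a nonnegative constant (the packaging `vertexFamily_vertexOfK'` and
`summable_colH_mul_of_locStencil` consume). -/
theorem Spr.decays' {K : MKer (d + 1) (Fib d)} (hK : Spr K) : ∃ δ C : ℝ, 0 < δ ∧ 0 ≤ C ∧ Decays K C δ := by
  obtain ⟨C, δ, hδ, h⟩ := hK
  have hC : 0 ≤ C := by
    have h0 := h 0 0 (Sum.inl 0) (Sum.inl 0)
    have h1 : 0 ≤ C * Real.exp (-δ * B12Sec2to5.l1 ((0 : Fin (d + 1) → ℤ) - 0)) := (abs_nonneg _).trans h0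
    exact nonneg_of_mul_nonneg_left h1 (Real.exp_pos _)
  exact ⟨δ, C, hδ, hC, h⟩

/-! ## §1 The vertex law through a generic reflection-invariant resolvent -/

/-- [folklore] **REFLECTION LAW OF THE `K`-GENERIC CHAIN-RULE VERTEX OF THE ROOTED STEP-0 STENCIL, WITH CONTACT**: for any
decaying packed kernel `K` with `refK (Φ Lc α) K = K`, under `2·cVH = −cE·Lc^{d+1}` and `Odd Lc`,
`vertexOfK K Lc S0NAt μ (bref α μ y) = ε • refK (Φ Lc α) (vertexOfK K Lc S0NAt μ y + W_K α μ y)`. -/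
theorem vertexOfK_S0NAt_bref (hLc : Odd Lc) {cE cVH : ℝ} (cΛ : ℝ) (hn : 2 * cVH = -(cE * (Lc : ℝ) ^ (d + 1)))
    {K : MKer (d + 1) (Fib d)} (hKs : Spr K) {α : Fin (d + 1)} (hKr : refK (Φ (d := d) Lc α) K = K) (μ : Fin (d + 1))
    (y : Fin (d + 1) → ℤ) :
    vertexOfK K Lc (S0NAt d Lc (ctr (d + 1) Lc) cE cVH cΛ) μ (bref α μ y) =
      reflSign α μ • refK (Φ (d := d) Lc α) (vertexOfK K Lc (S0NAt d Lc (ctr (d + 1) Lc) cE cVH cΛ) μ y +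
        conjV (bhKAt d (ctr (d + 1) Lc) Lc) ((cVH / (Lc : ℝ) ^ (d + 1)) •
          diagK (fun p c => ∑ κ, ∑' u, colH K Lc μ y κ u * ctGen d α Lc κ u p c))) := by
  have hLc1 : 1 ≤ Lc := hLc.pos
  have hKd := Spr.decays' hKs
  obtain ⟨Cs, δs, hδs, hS0⟩ := locStencil_S0NAt (d := d) (Lc := Lc) hLc1 (ctrOff_mem_box hLc1) cE cVH cΛ
  -- the stencil law, scalar pushed into the generator symbol
  have hSr : ∀ κ' u, S0NAt d Lc (ctr (d + 1) Lc) cE cVH cΛ κ' (bref α κ' u) =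
      reflSign α κ' • refK (Φ Lc α) (S0NAt d Lc (ctr (d + 1) Lc) cE cVH cΛ κ' u +
        conjV (bhKAt d (ctr (d + 1) Lc) Lc) (diagK fun p c => cVH / (Lc : ℝ) ^ (d + 1) * ctGen d α Lc κ' u p c)) := by
    intro κ' u
    rw [S0NAt_bref hLc cΛ hn α κ' u, smul_diagK]
  have hS : ∀ (μ : Fin (d + 1)) (y : Fin (d + 1) → ℤ) (κ' : Fin (d + 1)) (x z : Fin (d + 1) → ℤ) (a b : Fib d),
      Summable fun u => colH K Lc μ y κ' u * S0NAt d Lc (ctr (d + 1) Lc) cE cVH cΛ κ' u x z a b :=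
    fun μ y κ' x z a b => summable_colH_mul_of_locStencil hKd hS0 hδs μ y κ' x z a b
  have hgs : ∀ (μ : Fin (d + 1)) (y : Fin (d + 1) → ℤ) (κ : Fin (d + 1)) (p : Fin (d + 1) → ℤ) (c : Fib d),
      Summable fun u => colH K Lc μ y κ u * (cVH / (Lc : ℝ) ^ (d + 1) * ctGen d α Lc κ u p c) :=
    fun μ y κ p c => ((summable_colH_mul_ctGen hKd hLc1 α μ y κ p c).mul_left (cVH / (Lc : ℝ) ^ (d + 1))).congr
      fun u => by ring
  have hC : ∀ (μ : Fin (d + 1)) (y : Fin (d + 1) → ℤ) (κ' : Fin (d + 1)) (x z : Fin (d + 1) → ℤ) (a b : Fib d),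
      Summable fun u => colH K Lc μ y κ' u *
        conjV (bhKAt d (ctr (d + 1) Lc) Lc) (diagK fun p c => cVH / (Lc : ℝ) ^ (d + 1) * ctGen d α Lc κ' u p c) x z a b := by
    intro μ y κ' x z a b
    simp only [conjV_diagK_apply]
    exact (((hgs μ y κ' z b).sub (hgs μ y κ' x a)).mul_left (bhKAt d (ctr (d + 1) Lc) Lc x z a b)).congr fun u => by ring
  have hGen : (fun p c => ∑ κ, ∑' u, colH K Lc μ y κ u * (cVH / (Lc : ℝ) ^ (d + 1) * ctGen d α Lc κ u p c))
      = fun p c => cVH / (Lc : ℝ) ^ (d + 1) * ∑ κ, ∑' u, colH K Lc μ y κ u * ctGen d α Lc κ u p c := by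
    funext p c
    rw [Finset.mul_sum]
    refine Finset.sum_congr rfl fun κ _ => ?_
    rw [← tsum_mul_left]
    exact tsum_congr fun u => by ring
  rw [vertexOfK_bref_contact hKr hSr hS hC μ y, vertexOfK_conjV_diagK _ _ Lc _ hgs μ y, hGen, smul_diagK]

/-! ## §2 Locality of the generic vertex and of its contact -/

/-- [folklore] The `K`-generic chain-rule vertex of the rooted step-0 stencil is localised, at every bond. -/
theorem loc_vertexOfK_S0NAt (hLc : 1 ≤ Lc) {K : MKer (d + 1) (Fib d)} (hKs : Spr K) (cE cVH cΛ : ℝ) (μ : Fin (d + 1))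
    (y : Fin (d + 1) → ℤ) : Loc (vertexOfK K Lc (S0NAt d Lc (ctr (d + 1) Lc) cE cVH cΛ) μ y) := by
  obtain ⟨Cs, δ, hδ, hS⟩ := locStencil_S0NAt (d := d) (Lc := Lc) hLc (ctrOff_mem_box hLc) cE cVH cΛ
  obtain ⟨Cv, δv, hδv, hV⟩ := vertexFamily_vertexOfK' (N := Lc) (Spr.decays' hKs) hS hδ
  exact ⟨_, _, Cv, δv, hδv, hV μ y⟩

/-- [folklore] **THE `K`-GENERIC LEVEL-1 CONTACT VERTEX IS LOCALISED** (it is `ε • refK Φ (V_K μ (bref y)) − V_K μ y`). -/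
theorem loc_contactK (hLc : Odd Lc) {cE cVH : ℝ} (cΛ : ℝ) (hn : 2 * cVH = -(cE * (Lc : ℝ) ^ (d + 1)))
    {K : MKer (d + 1) (Fib d)} (hKs : Spr K) {α : Fin (d + 1)} (hKr : refK (Φ (d := d) Lc α) K = K) (μ : Fin (d + 1))
    (y : Fin (d + 1) → ℤ) :
    Loc (conjV (bhKAt d (ctr (d + 1) Lc) Lc) ((cVH / (Lc : ℝ) ^ (d + 1)) •
      diagK (fun p c => ∑ κ, ∑' u, colH K Lc μ y κ u * ctGen d α Lc κ u p c))) := by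
  have hLc1 : 1 ≤ Lc := hLc.pos
  rw [contact_eq_of_law (vertexOfK_S0NAt_bref (d := d) hLc cΛ hn hKs hKr μ y)]
  exact ((loc_refK_Φ hLc1 α (loc_vertexOfK_S0NAt hLc1 hKs cE cVH cΛ μ _)).smul _).sub
    (loc_vertexOfK_S0NAt hLc1 hKs cE cVH cΛ μ y)

/-! ## §3 The sandwich law, its field–field entries, and the reduction of the socket to a contact evaluation -/

/-- [folklore] **THE REFLECTION LAW OF THE `K`-GENERIC LEVEL-1 THIRD JET, CONTACT EXPLICIT**: for any spread packed kernel `K`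
with `refK (Φ Lc α) K = K`, under `2·cVH = −cE·Lc^{d+1}` and `Odd Lc`,
`−mmRead Lc (K ∘ V_K μ (bref α μ y) ∘ K) = ε • refK (Φ Lc α) (−mmRead Lc (K ∘ V_K μ y ∘ K) + −mmRead Lc (K ∘ W_K α μ y ∘ K))`. -/
theorem neg_mmRead_sandwich_vertexOfK_S0NAt_bref (hLc : Odd Lc) {cE cVH : ℝ} (cΛ : ℝ)
    (hn : 2 * cVH = -(cE * (Lc : ℝ) ^ (d + 1))) {K : MKer (d + 1) (Fib d)} (hKs : Spr K) {α : Fin (d + 1)}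
    (hKr : refK (Φ (d := d) Lc α) K = K) (μ : Fin (d + 1)) (y : Fin (d + 1) → ℤ) :
    -mmRead Lc (comp (comp K (vertexOfK K Lc (S0NAt d Lc (ctr (d + 1) Lc) cE cVH cΛ) μ (bref α μ y))) K) =
      reflSign α μ • refK (Φ (d := d) Lc α)
        (-mmRead Lc (comp (comp K (vertexOfK K Lc (S0NAt d Lc (ctr (d + 1) Lc) cE cVH cΛ) μ y)) K) +
          -mmRead Lc (comp (comp K (conjV (bhKAt d (ctr (d + 1) Lc) Lc) ((cVH / (Lc : ℝ) ^ (d + 1)) •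
            diagK (fun p c => ∑ κ, ∑' u, colH K Lc μ y κ u * ctGen d α Lc κ u p c)))) K)) := by
  have hLc1 : 1 ≤ Lc := hLc.pos
  have hKt : Tame K := hKs.tame
  have hVl : ∀ y', Loc (vertexOfK K Lc (S0NAt d Lc (ctr (d + 1) Lc) cE cVH cΛ) μ y') :=
    fun y' => loc_vertexOfK_S0NAt hLc1 hKs cE cVH cΛ μ y'
  have hWl := loc_contactK (d := d) hLc cΛ hn hKs hKr μ y
  exact neg_mmRead_sandwich_bref (M := Lc) (N' := Lc)
    (V := fun μ' y' => vertexOfK K Lc (S0NAt d Lc (ctr (d + 1) Lc) cE cVH cΛ) μ' y')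
    (W := fun μ' y' => conjV (bhKAt d (ctr (d + 1) Lc) Lc) ((cVH / (Lc : ℝ) ^ (d + 1)) •
      diagK (fun p c => ∑ κ, ∑' u, colH K Lc μ' y' κ u * ctGen d α Lc κ u p c)))
    hKr (vertexOfK_S0NAt_bref (d := d) hLc cΛ hn hKs hKr μ y)
    (fun x z a f b => slice_tame hKt (hVl y).tame x z a f b) (fun x z a f b => slice_tame hKt hWl.tame x z a f b)
    (fun x z a f b => slice_tame (hKs.comp_loc (hVl y)).tame hKt x z a f b)
    (fun x z a f b => slice_tame (hKs.comp_loc hWl).tame hKt x z a f b)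

/-- [folklore] **THE SAME LAW ON FIELD–FIELD ENTRIES, in the spelling of the socket `hE3ff`** (contact slot = `𝒞_K α μ y` read at the
reflected sites). -/
theorem neg_mmRead_sandwich_vertexOfK_S0NAt_bref_inl_inl (hLc : Odd Lc) {cE cVH : ℝ} (cΛ : ℝ)
    (hn : 2 * cVH = -(cE * (Lc : ℝ) ^ (d + 1))) {K : MKer (d + 1) (Fib d)} (hKs : Spr K) {α : Fin (d + 1)}
    (hKr : refK (Φ (d := d) Lc α) K = K) (μ : Fin (d + 1)) (y x z : Fin (d + 1) → ℤ) (a b : Fin (d + 1)) :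
    (-mmRead Lc (comp (comp K (vertexOfK K Lc (S0NAt d Lc (ctr (d + 1) Lc) cE cVH cΛ) μ (bref α μ y))) K))
        x z (Sum.inl a) (Sum.inl b) =
      reflSign α μ * ((Φ (d := d) Lc α).s (Sum.inl a) * (Φ (d := d) Lc α).s (Sum.inl b) *
        ((-mmRead Lc (comp (comp K (vertexOfK K Lc (S0NAt d Lc (ctr (d + 1) Lc) cE cVH cΛ) μ y)) K))
            ((Φ (d := d) Lc α).r (Sum.inl a) x) ((Φ (d := d) Lc α).r (Sum.inl b) z) (Sum.inl a) (Sum.inl b) +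
          (-mmRead Lc (comp (comp K (conjV (bhKAt d (ctr (d + 1) Lc) Lc) ((cVH / (Lc : ℝ) ^ (d + 1)) •
            diagK (fun p c => ∑ κ, ∑' u, colH K Lc μ y κ u * ctGen d α Lc κ u p c)))) K))
            ((Φ (d := d) Lc α).r (Sum.inl a) x) ((Φ (d := d) Lc α).r (Sum.inl b) z) (Sum.inl a) (Sum.inl b))) := by
  rw [neg_mmRead_sandwich_vertexOfK_S0NAt_bref hLc cΛ hn hKs hKr μ y]
  simp only [Pi.smul_apply, smul_eq_mul, refK_apply, Pi.add_apply]

/-- [folklore] **THE (L3-D) SOCKET AT LEVEL 1 IS A CONTACT EVALUATION.**  For any candidate kernel `C′`, the `hE3ff`-shaped law for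
the `K`-generic third jet with `C′` in the contact slot holds at `(α, μ, y)` on all field–field entries IFF `𝒞_K α μ y` and `C′`
have the same field–field block. -/
theorem e3KLaw_ff_iff (hLc : Odd Lc) {cE cVH : ℝ} (cΛ : ℝ) (hn : 2 * cVH = -(cE * (Lc : ℝ) ^ (d + 1)))
    {K : MKer (d + 1) (Fib d)} (hKs : Spr K) {α : Fin (d + 1)} (hKr : refK (Φ (d := d) Lc α) K = K) (μ : Fin (d + 1))
    (y : Fin (d + 1) → ℤ) (C' : MKer (d + 1) (Fib d)) :
    (∀ (x z : Fin (d + 1) → ℤ) (a b : Fin (d + 1)),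
      (-mmRead Lc (comp (comp K (vertexOfK K Lc (S0NAt d Lc (ctr (d + 1) Lc) cE cVH cΛ) μ (bref α μ y))) K))
          x z (Sum.inl a) (Sum.inl b) =
        reflSign α μ * ((Φ (d := d) Lc α).s (Sum.inl a) * (Φ (d := d) Lc α).s (Sum.inl b) *
          ((-mmRead Lc (comp (comp K (vertexOfK K Lc (S0NAt d Lc (ctr (d + 1) Lc) cE cVH cΛ) μ y)) K))
              ((Φ (d := d) Lc α).r (Sum.inl a) x) ((Φ (d := d) Lc α).r (Sum.inl b) z) (Sum.inl a) (Sum.inl b) +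
            C' ((Φ (d := d) Lc α).r (Sum.inl a) x) ((Φ (d := d) Lc α).r (Sum.inl b) z) (Sum.inl a) (Sum.inl b)))) ↔
    (∀ (x z : Fin (d + 1) → ℤ) (a b : Fin (d + 1)),
      (-mmRead Lc (comp (comp K (conjV (bhKAt d (ctr (d + 1) Lc) Lc) ((cVH / (Lc : ℝ) ^ (d + 1)) •
        diagK (fun p c => ∑ κ, ∑' u, colH K Lc μ y κ u * ctGen d α Lc κ u p c)))) K))
        x z (Sum.inl a) (Sum.inl b) = C' x z (Sum.inl a) (Sum.inl b)) := by
  have hε : reflSign α μ ≠ 0 := fun h => by simpa [h] using reflSign_mul_self α μ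
  have hs : ∀ c : Fib d, (Φ (d := d) Lc α).s c ≠ 0 := fun c h => by simpa [h] using (Φ (d := d) Lc α).s_mul_s c
  constructor
  · intro h x z a b
    have h1 := h ((Φ (d := d) Lc α).r (Sum.inl a) x) ((Φ (d := d) Lc α).r (Sum.inl b) z) a b
    rw [neg_mmRead_sandwich_vertexOfK_S0NAt_bref_inl_inl hLc cΛ hn hKs hKr, Φ_r_r, Φ_r_r] at h1
    have h2 := mul_left_cancel₀ hε h1
    have h3 := mul_left_cancel₀ (mul_ne_zero (hs _) (hs _)) h2
    exact add_left_cancel h3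
  · intro h x z a b
    rw [neg_mmRead_sandwich_vertexOfK_S0NAt_bref_inl_inl hLc cΛ hn hKs hKr, h]

end Summit.QuantumFields.BalabanUV.Beta.E3GenericReflection

end
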